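import Summits.CriticalPhenomena.CardyFormulaZ2.Theorems.CardyMagicRigidityPinchResamplingDefs
import HarnessLib

/-!
# Crux `NestingRigidity`, line `pinch-resampling` (v2), stub S3: lattice geometry of the Φ-symmetric gadget

Crux `Summit.CriticalPhenomena.CardyFormulaZ2.Theses.CardyMagicRigidity.NestingRigidity`
(stmt-CriticalPhenomena-4835), line `pinch-resampling` v2, vocabulary `CardyMagicRigidityPinchResamplingDefs`.
The docstring of `zMedDualBlock` asserts that the dual half `zMedDualBlock y m` of the medial gadget is the image
of the primal half `zMedBlock y m` under the quarter turn `ρ` about the MEDIAL vertex `y + (½, 0)`, which maps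
`ℤ²` onto the dual lattice, and that `ρ²` (the point reflection in `y + (½, 0)`) fixes both blocks — the lattice
half of the `Φ`-symmetry `Φ := ρ_* ∘ (dual) ∘ (complement)` behind the fair special case `PairFairZ2` (§A of the
skeleton).  This file CHECKS these lattice statements in Lean (stub S3 brief, item B4), written with the maps in
coordinates (dual vertices indexed by lower-left corners, as in `dualEdge`: the dual vertex `u` sits at
`u + (½, ½)`):

* `ρ` on primal vertices, valued in dual indices: `v ↦ (y₀ + y₁ − v₁, v₀ − y₀ + y₁ − 1)`;
* `ρ` on dual indices, valued in primal vertices: `u ↦ (y₀ + y₁ − u₁, u₀ − y₀ + y₁)`;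
* `ρ²`: the point reflections `v ↦ (2y₀ + 1 − v₀, 2y₁ − v₁)` (primal) and `u ↦ (2y₀ − u₀, 2y₁ − 1 − u₁)` (dual).

Proved: `ρ` maps `zMedBlock y m` exactly onto `zMedDualBlock y m` and `zMedDualBlock y m` exactly onto
`zMedBlock y m` (registered anchor `quarterTurn_mem_zMedDualBlock_iff`, and `quarterTurn_dual_mem_zMedBlock_iff`),
the two composites are the point reflections (`quarterTurn_dual_quarterTurn`, `quarterTurn_quarterTurn_dual`), which
fix the blocks (`pointReflection_mem_zMedBlock_iff`, `pointReflection_dual_mem_zMedDualBlock_iff`), and `ρ` is a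
lattice isomorphism (`quarterTurn_adj_iff`).  CAVEAT recorded for §A: `ρ` does NOT map the outer primal box
`Λ_{2n}(x)` (side `4n + 1`) onto any outer dual box `zDualBall x' (2n)` (side `4n + 2`) — already
`zBall x 0 = {x}` is a point while `zDualBall x 0` has the two distinct elements `x` and `x - 1`
(`zBall_zero`, `mem_zDualBall_zero`) — so `Φ` swaps the two halves of the GADGET exactly but fixes the pinch
event `ZPinch x y m n` only up to its outer boundary (where stub S3, exterior forgetting, is what makes the
symmetry usable).  Nothing here is asserted beyond what is proved; no measure enters.
-/

noncomputable section

namespace Summit.CriticalPhenomena.CardyFormulaZ2.Cruxes.NestingRigidity.PinchResampling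

open Literature.Probability.Percolation Literature.Probability.LatticeModels

/-! ## The quarter turn swaps the two halves of the gadget -/

/-- **The quarter turn `ρ` about the medial vertex maps the primal gadget block onto the dual one** (registered
helper, stub S3 item B4): in lower-left-corner dual indices, `ρ v = (y₀ + y₁ − v₁, v₀ − y₀ + y₁ − 1)` lies in
`zMedDualBlock y m` iff `v ∈ zMedBlock y m`. -/
theorem quarterTurn_mem_zMedDualBlock_iff : ∀ (y v : Site 2) (m : ℕ), (![y 0 + y 1 - v 1, v 0 - y 0 + y 1 - 1] : Site 2) ∈ zMedDualBlock y m ↔ v ∈ zMedBlock y m := by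
  intro y v m
  simp only [zMedDualBlock, zMedBlock, Set.mem_setOf_eq, Matrix.cons_val_zero, Matrix.cons_val_one,
    Matrix.cons_val_fin_one, abs_le]
  omega

/-- `ρ` on dual indices, `u ↦ (y₀ + y₁ − u₁, u₀ − y₀ + y₁)`, maps the dual gadget block onto the primal one. -/
theorem quarterTurn_dual_mem_zMedBlock_iff (y u : Site 2) (m : ℕ) :
    (![y 0 + y 1 - u 1, u 0 - y 0 + y 1] : Site 2) ∈ zMedBlock y m ↔ u ∈ zMedDualBlock y m := by
  simp only [zMedDualBlock, zMedBlock, Set.mem_setOf_eq, Matrix.cons_val_zero, Matrix.cons_val_one,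
    Matrix.cons_val_fin_one, abs_le]
  omega

/-- `ρ ∘ ρ` on primal vertices is the point reflection `v ↦ (2y₀ + 1 − v₀, 2y₁ − v₁)` in `y + (½, 0)`. -/
theorem quarterTurn_dual_quarterTurn (y v : Site 2) :
    (![y 0 + y 1 - (![y 0 + y 1 - v 1, v 0 - y 0 + y 1 - 1] : Site 2) 1,
        (![y 0 + y 1 - v 1, v 0 - y 0 + y 1 - 1] : Site 2) 0 - y 0 + y 1] : Site 2) =
      ![2 * y 0 + 1 - v 0, 2 * y 1 - v 1] := by
  simp only [Matrix.cons_val_zero, Matrix.cons_val_one, Matrix.cons_val_fin_one]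
  ext i
  fin_cases i <;> simp <;> ring

/-- `ρ ∘ ρ` on dual indices is the point reflection `u ↦ (2y₀ − u₀, 2y₁ − 1 − u₁)` (the same point reflection
in `y + (½, 0)`, written in lower-left-corner indices). -/
theorem quarterTurn_quarterTurn_dual (y u : Site 2) :
    (![y 0 + y 1 - (![y 0 + y 1 - u 1, u 0 - y 0 + y 1] : Site 2) 1,
        (![y 0 + y 1 - u 1, u 0 - y 0 + y 1] : Site 2) 0 - y 0 + y 1 - 1] : Site 2) =
      ![2 * y 0 - u 0, 2 * y 1 - 1 - u 1] := by
  simp only [Matrix.cons_val_zero, Matrix.cons_val_one, Matrix.cons_val_fin_one]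
  ext i
  fin_cases i <;> simp <;> ring

/-- The point reflection in the medial vertex fixes the primal gadget block. -/
theorem pointReflection_mem_zMedBlock_iff (y v : Site 2) (m : ℕ) :
    (![2 * y 0 + 1 - v 0, 2 * y 1 - v 1] : Site 2) ∈ zMedBlock y m ↔ v ∈ zMedBlock y m := by
  simp only [zMedBlock, Set.mem_setOf_eq, Matrix.cons_val_zero, Matrix.cons_val_one,
    Matrix.cons_val_fin_one, abs_le]
  omega

/-- The point reflection in the medial vertex fixes the dual gadget block. -/
theorem pointReflection_dual_mem_zMedDualBlock_iff (y u : Site 2) (m : ℕ) :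
    (![2 * y 0 - u 0, 2 * y 1 - 1 - u 1] : Site 2) ∈ zMedDualBlock y m ↔ u ∈ zMedDualBlock y m := by
  simp only [zMedDualBlock, Set.mem_setOf_eq, Matrix.cons_val_zero, Matrix.cons_val_one,
    Matrix.cons_val_fin_one, abs_le]
  omega

/-! ## The quarter turn is a lattice isomorphism -/

/-- Adjacency in `ℤ²`, in coordinates. -/
theorem zdGraph_two_adj_iff (v w : Site 2) :
    (zdGraph 2).Adj v w ↔
      (w 0 = v 0 + 1 ∧ w 1 = v 1) ∨ (w 0 = v 0 ∧ w 1 = v 1 + 1) ∨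
        (v 0 = w 0 + 1 ∧ v 1 = w 1) ∨ (v 0 = w 0 ∧ v 1 = w 1 + 1) := by
  rw [zdGraph_adj_iff]
  constructor
  · rintro ⟨i, h | h⟩
    · have h0 := congr_fun h 0
      have h1 := congr_fun h 1
      fin_cases i
      · simp at h0 h1; omega
      · simp at h0 h1; omega
    · have h0 := congr_fun h 0
      have h1 := congr_fun h 1
      fin_cases i
      · simp at h0 h1; omega
      · simp at h0 h1; omega
  · rintro (h | h | h | h)
    · refine ⟨0, Or.inl ?_⟩; ext i; fin_cases i <;> simp <;> omega
    · refine ⟨1, Or.inl ?_⟩; ext i; fin_cases i <;> simp <;> omega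
    · refine ⟨0, Or.inr ?_⟩; ext i; fin_cases i <;> simp <;> omega
    · refine ⟨1, Or.inr ?_⟩; ext i; fin_cases i <;> simp <;> omega

/-- **`ρ` is a lattice isomorphism** from `ℤ²` onto the dual lattice (indexed by `ℤ²`): it preserves and
reflects adjacency. -/
theorem quarterTurn_adj_iff (y v w : Site 2) :
    (zdGraph 2).Adj (![y 0 + y 1 - v 1, v 0 - y 0 + y 1 - 1] : Site 2)
        (![y 0 + y 1 - w 1, w 0 - y 0 + y 1 - 1] : Site 2) ↔ (zdGraph 2).Adj v w := by
  rw [zdGraph_two_adj_iff, zdGraph_two_adj_iff]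
  simp only [Matrix.cons_val_zero, Matrix.cons_val_one, Matrix.cons_val_fin_one]
  omega

/-! ## Caveat: the outer boxes are not exchanged -/

/-- The primal box of radius `0` is a point. -/
theorem zBall_zero (x : Site 2) : zBall x 0 = {x} := by
  ext v
  simp only [zBall, zNorm, Set.mem_setOf_eq, Pi.sub_apply, CharP.cast_eq_zero, Set.mem_singleton_iff,
    max_le_iff, abs_nonpos_iff, sub_eq_zero]
  constructor
  · rintro ⟨h0, h1⟩; ext i; fin_cases i <;> assumption
  · rintro rfl; exact ⟨rfl, rfl⟩

/-- The dual box of radius `½` already contains the two distinct indices `x` and `x - 1`: the outer primal box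
`Λ_{2n}(x)` (odd side `4n + 1`) and the outer dual boxes `zDualBall x' (2n)` (even side `4n + 2`) are never in
bijection, so `Φ` does not fix `ZPinch x y m n` exactly — only its gadget. -/
theorem mem_zDualBall_zero (x : Site 2) : x ∈ zDualBall x 0 ∧ x - 1 ∈ zDualBall x 0 ∧ x ≠ x - 1 := by
  refine ⟨?_, ?_, fun h ↦ ?_⟩
  · simp [zDualBall, zNorm]
  · simp only [zDualBall, zNorm, Set.mem_setOf_eq, sub_sub_cancel_left, smul_neg, Pi.add_apply, Pi.neg_apply,
      Pi.smul_apply, Pi.one_apply, CharP.cast_eq_zero, mul_zero, zero_add]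
    norm_num
  · have := congr_fun h 0
    simp only [Pi.sub_apply, Pi.one_apply] at this
    omega

end Summit.CriticalPhenomena.CardyFormulaZ2.Cruxes.NestingRigidity.PinchResampling

end
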